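import Mathlib
import Summits.ResolutionOfSingularities.ResolutionOfSingularities.Theorems.RadicialJungCleanModelsGenericSpread
import Literature.AlgebraicGeometry.Hironaka2017.Lib.RsopSpread
import Literature.AlgebraicGeometry.Resolution.StrictNormalCrossingsFlatDescent
import Literature.AlgebraicGeometry.Resolution.GenericPointStalkData
import Literature.AlgebraicGeometry.Resolution.TransverseCentreEffectiveCartier
import HarnessLib

/-!
# Route `RadicialJung`, crux `CleanModels` (stmt-ResolutionOfSingularities-15917), line `Sketch` rev 35, stub 6 `stub_cleanProp44` (X44c),
# work plan O8 / L7b-global, item (G1) on the SCHEME: clean-regular at the generic point of a regular curve ⟹ on an open neighbourhood of the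
# generic point, every point of the curve is clean-permissible or deficient

Memo `Cruxes/CleanModels/Lines/Sketch-memo-hand2-g9-stubs-5-7.md` §3a (G1).  Scheme reading of ✓ `exists_not_mem_forall_cleanPermissibleAt_or_deficient_of_cleanRegAt_generic`
(`…GenericSpread.lean`): on a regular integral locally Noetherian `X₀` (`char K(X₀) = p`), `C₀ = cl{η}` a regular curve (ideal generated by a regular pair at
each point) with `dim 𝒪_{X₀,η} = 2`, if the line of `G` is clean-regular at `η` then there is an open `W ∋ η` such that at EVERY point `y ∈ W ∩ C₀` the
line is clean-permissible for `C₀`, or has a unit representative which is a `p`-th power modulo `𝓘_{C₀,y} + 𝔪_y²` (the deficiency, only for type (2) at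
`η`).  Plumbing: an affine `V ∋ η` with sections `q₀, q₁` whose germs are a regular pair generating `𝓘_{C₀}` at every point of `V ∩ C₀`
(✓ `exists_affineOpen_forall_isRsopPart_germ`), `𝒪_{X₀,y} = Γ(V)_{𝔮_y}`, `𝓘_{C₀,y} = 𝔭_η 𝒪_{X₀,y}` (✓ `stalkIdeal_vanishingIdeal_closure`,
✓ `primeOfSpecializes_eq_map_germ`), `W = D(g)`.

Honest framing: OURS (bookkeeping); with L7b (✓ p816242) and (G2)/(G3) this leaves, for L7b-global, only the finiteness of the deficient points
(type (2) at `η`; memo §3a) and the output predicate for X44c's re-threading; nothing here proves X44c or any case of `CleanModels`.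
-/

noncomputable section

set_option linter.dupNamespace false -- mandated namespace of this single-conjunct summit

open CategoryTheory AlgebraicGeometry TopologicalSpace IsLocalRing Opposite
open Literature.AlgebraicGeometry.Resolution Literature.AlgebraicGeometry.Motives
open Scheme.IdealSheafData

namespace Summit.ResolutionOfSingularities.ResolutionOfSingularities.Theorems.RadicialJung.CleanModels

/-- **(G1) on the scheme.**  See the module docstring. [cite: CossartPiltant2008, Prop. 4.4 (proof, p. 10)] [cite: Piltant2013, §2 Axiom 4]
[cite: Matsumura1987, Thm. 14.2] -/
theorem exists_isOpen_forall_cleanPermissibleAt_or_deficient_of_cleanRegAt_genericPoint {X₀ : Scheme.{0}} [IsIntegral X₀]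
    [IsLocallyNoetherian X₀] (hX₀ : Scheme.IsRegular X₀) (p : ℕ) [hp : Fact p.Prime] [CharP X₀.functionField p] {C₀ : Closeds X₀}
    (hC₀reg : ∀ y ∈ (C₀ : Set X₀), ∃ c : Fin 2 → X₀.presheaf.stalk y,
      IsRsopPart c ∧ Ideal.span (Set.range c) = stalkIdeal (vanishingIdeal C₀) y)
    {η : X₀} (hη : (C₀ : Set X₀) = closure {η}) (hdimη : ringKrullDim (X₀.presheaf.stalk η) = 2)
    (G : X₀.functionField) (hGη : CleanRegAt p (RatFn.toFunctionField η) G) :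
    ∃ W : X₀.Opens, η ∈ W ∧ ∀ y ∈ (C₀ : Set X₀), y ∈ W →
      CleanPermissibleAt p (RatFn.toFunctionField y) G (stalkIdeal (vanishingIdeal C₀) y) ∨
        ∃ (cc : Fin p → X₀.functionField) (w c : X₀.presheaf.stalk y), (∃ j : Fin p, (j : ℕ) ≠ 0 ∧ cc j ≠ 0) ∧ IsUnit w ∧
          (∑ j : Fin p, cc j ^ p * G ^ (j : ℕ)) = RatFn.toFunctionField y w ∧
          w - c ^ p ∈ stalkIdeal (vanishingIdeal C₀) y ⊔ maximalIdeal (X₀.presheaf.stalk y) ^ 2 := by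
  classical
  have hηC : η ∈ (C₀ : Set X₀) := by rw [hη]; exact subset_closure rfl
  have hregC : Scheme.IsRegular (vanishingIdeal C₀).subscheme :=
    isRegular_subscheme_vanishingIdeal_of_forall_isRsopPart fun x hx => by
      obtain ⟨c, hc, h⟩ := hC₀reg x hx
      exact ⟨2, c, hc, h⟩
  obtain ⟨V, hηV, r, q, hgerm⟩ := exists_affineOpen_forall_isRsopPart_germ C₀ hregC (fun x _ => hX₀ x) hηC
  -- `𝒪_{X₀,η} = Γ(V)_𝔭`
  haveI : Nonempty (V : X₀.Opens) := ⟨⟨η, hηV⟩⟩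
  haveI : IsNoetherianRing Γ(X₀, V) := IsLocallyNoetherian.component_noetherian V
  let xη : (V : X₀.Opens) := ⟨η, hηV⟩
  letI algη : Algebra Γ(X₀, V) (X₀.presheaf.stalk η) := TopCat.Presheaf.algebra_section_stalk X₀.presheaf xη
  haveI hlocη : IsLocalization.AtPrime (X₀.presheaf.stalk η) (V.2.primeIdealOf xη).asIdeal := V.2.isLocalization_stalk xη
  haveI : IsFractionRing Γ(X₀, V) X₀.functionField := functionField_isFractionRing_of_isAffineOpen (U := (V : X₀.Opens)) (hU := V.2)
  haveI : IsScalarTower Γ(X₀, V) (X₀.presheaf.stalk η) X₀.functionField := functionField_isScalarTower X₀ (V : X₀.Opens) xη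
  set 𝔭 := (V.2.primeIdealOf xη).asIdeal with h𝔭
  have halgη : ∀ f : Γ(X₀, V), algebraMap Γ(X₀, V) (X₀.presheaf.stalk η) f = (X₀.presheaf.germ V η hηV).hom f := fun f => rfl
  -- `r = 2`
  obtain ⟨hgη, hspanη⟩ := hgerm η hηV hηC
  have hmaxη : stalkIdeal (vanishingIdeal C₀) η = maximalIdeal (X₀.presheaf.stalk η) :=
    stalkIdeal_vanishingIdeal_eq_maximalIdeal_of_closure_eq hη
  have hr2 : r = 2 := by
    have h1 := hgη.height_span_range
    rw [hspanη, hmaxη] at h1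
    have h2 : ((maximalIdeal (X₀.presheaf.stalk η)).height : WithBot ℕ∞) = 2 := by
      rw [IsLocalRing.maximalIdeal_height_eq_ringKrullDim, hdimη]
    rw [h1] at h2
    have h3 : ((r : ℕ∞) : WithBot ℕ∞) = (((2 : ℕ) : ℕ∞) : WithBot ℕ∞) := by rw [h2]; norm_cast
    exact ENat.coe_inj.mp (WithBot.coe_injective h3)
  subst hr2
  have hq : Ideal.map (algebraMap Γ(X₀, V) (X₀.presheaf.stalk η)) (Ideal.span (Set.range q)) = maximalIdeal (X₀.presheaf.stalk η) := by
    rw [Ideal.map_span, ← hmaxη, ← hspanη]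
    congr 1
    ext z; simp only [Set.mem_image, Set.mem_range]
    constructor
    · rintro ⟨_, ⟨j, rfl⟩, rfl⟩; exact ⟨j, (halgη _).symm⟩
    · rintro ⟨j, rfl⟩; exact ⟨q j, ⟨j, rfl⟩, halgη _⟩
  -- the ring-level theorem
  obtain ⟨g, hg𝔭, hall⟩ := exists_not_mem_forall_cleanPermissibleAt_or_deficient_of_cleanRegAt_generic p 𝔭 (X₀.presheaf.stalk η)
    q hq hdimη G hGη
  -- `W = D(g)`
  refine ⟨X₀.basicOpen g, ?_, fun y hyC hyW => ?_⟩
  · rw [Scheme.mem_basicOpen _ _ _ hηV, ← halgη]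
    exact (IsLocalization.AtPrime.isUnit_to_map_iff (X₀.presheaf.stalk η) 𝔭 g).mpr hg𝔭
  have hyV : y ∈ (V : X₀.Opens) := X₀.basicOpen_le g hyW
  haveI : IsRegularLocalRing (X₀.presheaf.stalk y) := hX₀ y
  let xy : (V : X₀.Opens) := ⟨y, hyV⟩
  letI algy : Algebra Γ(X₀, V) (X₀.presheaf.stalk y) := TopCat.Presheaf.algebra_section_stalk X₀.presheaf xy
  haveI hlocy : IsLocalization.AtPrime (X₀.presheaf.stalk y) (V.2.primeIdealOf xy).asIdeal := V.2.isLocalization_stalk xy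
  haveI : IsScalarTower Γ(X₀, V) (X₀.presheaf.stalk y) X₀.functionField := functionField_isScalarTower X₀ (V : X₀.Opens) xy
  set 𝔮 := (V.2.primeIdealOf xy).asIdeal with h𝔮
  have halgy : ∀ f : Γ(X₀, V), algebraMap Γ(X₀, V) (X₀.presheaf.stalk y) f = (X₀.presheaf.germ V y hyV).hom f := fun f => rfl
  have hg𝔮 : g ∉ 𝔮 := by
    have h1 : IsUnit ((X₀.presheaf.germ V y hyV).hom g) := (Scheme.mem_basicOpen _ _ _ hyV).mp hyW
    rw [← halgy] at h1
    exact (IsLocalization.AtPrime.isUnit_to_map_iff (X₀.presheaf.stalk y) 𝔮 g).mp h1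
  obtain ⟨hgy, hspany⟩ := hgerm y hyV hyC
  -- `𝓘_{C₀,y} = 𝔭 𝒪_{X₀,y}`
  have hspec : η ⤳ y := by rw [specializes_iff_mem_closure, ← hη]; exact hyC
  have hC₀ : C₀ = ⟨closure {η}, isClosed_closure⟩ := Closeds.ext hη
  have hIy : stalkIdeal (vanishingIdeal C₀) y = Ideal.map (algebraMap Γ(X₀, V) (X₀.presheaf.stalk y)) 𝔭 := by
    have h1 : stalkIdeal (vanishingIdeal C₀) y = primeOfSpecializes hspec := by
      have := stalkIdeal_vanishingIdeal_closure (X := X₀) hspec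
      rwa [← hC₀] at this
    rw [h1, primeOfSpecializes_eq_map_germ hspec V hyV]
    rfl
  have hqs : Ideal.span (Set.range fun j => algebraMap Γ(X₀, V) (X₀.presheaf.stalk y) (q j)) =
      Ideal.map (algebraMap Γ(X₀, V) (X₀.presheaf.stalk y)) 𝔭 := by rw [← hIy, ← hspany]; rfl
  rcases hall 𝔮 hg𝔮 (X₀.presheaf.stalk y) hgy hqs with ⟨cc', -, hperm⟩ | ⟨cc', w, c, hcc', hw, hXw, hwc⟩
  · left; rw [hIy]; exact hperm
  · right; exact ⟨cc', w, c, hcc', hw, hXw, by rw [hIy]; exact hwc⟩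

end Summit.ResolutionOfSingularities.ResolutionOfSingularities.Theorems.RadicialJung.CleanModels

end
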